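import Summits.QuantumFields.YangMills.Theorems.BalabanUVNodesC44IterMhStability
import HarnessLib

/-!
# (ℓa-C) ROAD B, FILE F4′-5 — THE TWO OUTPUT LETTERS OF THE k-FREE POLYDISC STABILITY: (a) every loop matrix of `Ū^j_h(e^{iX}U₀)`, `j < k`, is within `1∕2` of `1`;
# (b) `‖Ū^k_h(e^{iX}U₀)(c)·Ū^k(U₀)(c)⋆ − 1‖ ≤ 1600(d+1)·L^k‖X‖_∞` — for TRACELESS `X` with `L^k‖X‖_∞ ≤ ρ₀(d,L)` and a background with a summable loop profile

Cell `pub-ymgap` ∕ `ym-nodeO-ideate`, porter lineage `ymgap-nodeO-port-PTB-1` (gen 7), hand «(44) for `iterMh`» (director-ym g22 №569/№571; PORT-PLAN-v5 dc7ff9950b0ac185,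
§ F4′-4).  `--kind proof --supports stmt-QuantumFields-27238 --as helper`; count-neutral.  [B7] = [Balaban1985Averaging]; [B11] = [Balaban1985Variational]; [I] = [Balaban1987RG1].

These are exactly the two guards of ✓`Node00.analyticAt_COfRecord` (`hpoly`, `hlog`) and the linear bound consumed by F4′-0 ✓`norm_logChart_iterMh_sub_qCplxOp_le_of_linearBound`, read off
F4′-4's ★★★`tower_induction` (`Ū^j_h = G_j • Ṽ_j`): loops conjugate by `G_j(emb c₋)` (F4′-1), `‖Ṽ_j(loop) − 1‖ ≤ 7κ_j + ε_j` (F4′-3a), and at the top `Ū^k_h(c)Ū^k(U₀)(c)⋆ =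
G(y)·(ṼW⋆)·(W G(y′)⁻¹ W⋆)`.

WHAT IS PROVED (0 def, 0 sorry, axioms standard; ns `Summit.QuantumFields.YangMills.Theorems.C44IterMh`).
* `norm_conj_inv_sub_one_le` (`‖GYG⁻¹ − 1‖ ≤ (1+g)(1+2g)‖Y − 1‖`), `level_sizes` (the level-`j` smallness facts from the top-scale hypotheses).
* ★★★ `norm_loopMh_iterMh_expOver_sub_one_le` — OUTPUT (a): `∀ j < k, ∀ c i, ‖loopMh (Ū^j_h(e^{iX}U₀)) c i − 1‖ ≤ 1∕2`.
* ★★★ `norm_iterMh_expOver_mul_star_sub_one_le` — OUTPUT (b): `∀ c, ‖Ū^k_h(e^{iX}U₀)(c)·Ū^k(U₀)(c)⋆ − 1‖ ≤ 1600(d+1)·(L^k‖X‖)`.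
Hypotheses (both): the (0.4) guard `SmallBelow … k U₀`; a loop profile `ε` of the real tower with `ε_j ≤ 1∕50`, `2A·L^k s₀ + B·Σ_{j<k}ε_j ≤ 1∕2`, `8(d+1)L^k s₀ ≤ 10⁻⁶`,
`N(56(d+1)L^k s₀ + ε_j) ≤ 3` (`s₀ = 2‖X‖`, `A = 2·10⁷(d+1)²L`, `B = 6·10⁴(d+1)`); `X` traceless.

HONEST FRAMING.  Corollaries of F4′-4; crude constants; TRACELESS slice and displayed loop profile only — not [B7] Props 1–3∕7 as printed.  (ℓa-C)(ℓa-H)(ℓd) DISPLAYED; (R1)∕(R2) OPEN;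
K0ᴬ ⟨stmt-QuantumFields-27238⟩ NOT closed; K0ᴬ∕K1ᴬ∕K3ᴬ 0∕3; NODE O 0∕1; COUNT 8∕28 · K 1∕4 UNMOVED; finite `𝕋⁴_{L^K}` at fixed ε — NOT continuum ∕ ℝ⁴ ∕ OS; **the Yang–Mills mass
gap (Clay) is NOT proved by any of this.**  No `sorry`, `instance`, `notation`, `set_option`; standard axioms.
-/

noncomputable section

open scoped Matrix Matrix.Norms.L2Operator

namespace Summit.QuantumFields.YangMills.Theorems.C44IterMh

open Literature.MathematicalPhysics.QuantumFieldTheory.Balaban1983to89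
open Literature.MathematicalPhysics.QuantumFieldTheory.Balaban1983to89.Node00
open T4Continuum BlockAveraging
open B15AveragingHolomorphic (holMh loopMh avgMh iterMh iterMh_zero iterMh_succ coeField_iter_eq_iterMh loopMh_coeField)
open ExpMeanLog (expMeanLogSU)

variable {P : Params} {N : ℕ} [NeZero N]

/-- `‖G·Y·G⁻¹ − 1‖ ≤ (1 + g)(1 + 2g)·‖Y − 1‖` for `det G = 1`, `‖G − 1‖ ≤ g ≤ 1∕2`. [cite: Balaban1985Averaging, (12) p.19 (gauge invariance; bookkeeping)] -/
theorem norm_conj_inv_sub_one_le {G Y : Matrix (Fin N) (Fin N) ℂ} (hG : G.det = 1) {g : ℝ} (hg : ‖G - 1‖ ≤ g) (hg2 : g ≤ 1 / 2) :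
    ‖G * Y * G⁻¹ - 1‖ ≤ (1 + g) * (1 + 2 * g) * ‖Y - 1‖ := by
  haveI : Nonempty (Fin N) := ⟨⟨0, Nat.pos_of_ne_zero (NeZero.ne N)⟩⟩
  have hid : G * Y * G⁻¹ - 1 = G * (Y - 1) * G⁻¹ := by rw [mul_sub, sub_mul, mul_one, sl_mul_inv_cancel hG]
  have hGn : ‖G‖ ≤ 1 + g := by
    have := norm_le_insert' G 1; rw [norm_one] at this; linarith [norm_sub_rev G 1]
  have hGi : ‖G⁻¹‖ ≤ 1 + 2 * g := by
    have h := norm_inv_sub_one_le_of_det (sl_isUnit_det hG) hg hg2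
    have := norm_le_insert' G⁻¹ 1; rw [norm_one] at this; linarith
  rw [hid]
  have hg0 : 0 ≤ g := (norm_nonneg _).trans hg
  calc ‖G * (Y - 1) * G⁻¹‖ ≤ ‖G‖ * ‖Y - 1‖ * ‖G⁻¹‖ := by
        refine (norm_mul_le _ _).trans (mul_le_mul_of_nonneg_right (norm_mul_le _ _) (norm_nonneg _))
    _ ≤ (1 + g) * ‖Y - 1‖ * (1 + 2 * g) := by gcongr
    _ = (1 + g) * (1 + 2 * g) * ‖Y - 1‖ := by ring

/-- **THE LEVEL-`j` SIZES FROM THE TOP-SCALE HYPOTHESES** (`j < k`): with `S = L^j s₀(1+2Q_j) ≤ 2L^j s₀` one has `S ≤ 1∕2`, `φ_j + λ_j ≤ 10⁻⁶` (hence all the one-step side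
conditions) and `128d·L^j s₀ ≤ 1∕4`. [folklore] -/
theorem level_sizes {d L k j : ℕ} (hd : 1 ≤ d) (hL : 2 ≤ L) (hjk : j < k) {s₀ Q : ℝ} (hs₀ : 0 ≤ s₀) (hQ0 : 0 ≤ Q) (hQ : Q ≤ 1 / 2)
    (hρ : 8 * ((d : ℝ) + 1) * ((L : ℝ) ^ k * s₀) ≤ 1 / 10 ^ 6) :
    (L : ℝ) ^ j * s₀ * (1 + 2 * Q) ≤ 1 / 2 ∧
      ((1 + 2 * ((L : ℝ) ^ j * s₀ * (1 + 2 * Q))) ^ (d * L) - 1) + ((1 + 2 * ((L : ℝ) ^ j * s₀ * (1 + 2 * Q))) ^ L - 1) ≤ 1 / 10 ^ 6 ∧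
      0 ≤ ((1 + 2 * ((L : ℝ) ^ j * s₀ * (1 + 2 * Q))) ^ (d * L) - 1) ∧ 0 ≤ ((1 + 2 * ((L : ℝ) ^ j * s₀ * (1 + 2 * Q))) ^ L - 1) ∧
      128 * (d : ℝ) * ((L : ℝ) ^ j * s₀) ≤ 1 / 4 := by
  have hd1 : (1 : ℝ) ≤ d := by exact_mod_cast hd
  have hL2 : (2 : ℝ) ≤ L := by exact_mod_cast hL
  have hL1 : (1 : ℝ) ≤ L := by linarith
  have hx0 : 0 ≤ (L : ℝ) ^ j * s₀ := mul_nonneg (pow_nonneg (by linarith) j) hs₀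
  have hxk : (L : ℝ) ^ j * s₀ * L ≤ (L : ℝ) ^ k * s₀ := by
    rw [mul_assoc, mul_comm s₀, ← mul_assoc, ← pow_succ]
    exact mul_le_mul_of_nonneg_right (pow_le_pow_right₀ hL1 hjk) hs₀
  have hxk' : (L : ℝ) ^ j * s₀ ≤ (L : ℝ) ^ k * s₀ := mul_le_mul_of_nonneg_right (pow_le_pow_right₀ hL1 hjk.le) hs₀
  set S := (L : ℝ) ^ j * s₀ * (1 + 2 * Q) with hS
  have hS0 : 0 ≤ S := by positivity
  have hS2 : S ≤ 2 * ((L : ℝ) ^ j * s₀) := by rw [hS]; nlinarith only [hx0, hQ]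
  have hLS : (L : ℝ) * S ≤ 2 * ((L : ℝ) ^ k * s₀) := by
    have := mul_le_mul_of_nonneg_left hS2 (by linarith only [hL1] : (0:ℝ) ≤ L)
    nlinarith only [this, hxk]
  have hd0 : (0:ℝ) ≤ d := by linarith only [hd1]
  have hρ0 : 0 ≤ (L : ℝ) ^ k * s₀ := hx0.trans hxk'
  have hdS : 2 * (d : ℝ) * L * S ≤ 1 := by
    have := mul_le_mul_of_nonneg_left hLS hd0
    nlinarith only [this, hρ, hd0, hρ0]
  obtain ⟨hκ4, -⟩ := consolidated_step_le hd (by omega : 1 ≤ L) hS0 le_rfl hdS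
  have hκ8 : 4 * ((d : ℝ) + 1) * L * S ≤ 8 * ((d : ℝ) + 1) * ((L : ℝ) ^ k * s₀) := by
    have := mul_le_mul_of_nonneg_left hLS (by linarith only [hd1] : (0:ℝ) ≤ 4 * ((d : ℝ) + 1))
    nlinarith only [this]
  have h1 : (1 : ℝ) ≤ (1 + 2 * S) ^ L := one_le_pow₀ (by linarith only [hS0])
  have h1' : (1 : ℝ) ≤ (1 + 2 * S) ^ (d * L) := one_le_pow₀ (by linarith only [hS0])
  refine ⟨?_, by linarith only [hκ4, hκ8, hρ], by linarith only [h1'], by linarith only [h1], ?_⟩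
  · have : S ≤ 2 * ((L : ℝ) ^ k * s₀) := hS2.trans (by linarith only [hxk'])
    have hdx := mul_le_mul_of_nonneg_right hd1 hρ0
    linarith only [this, hρ, hdx, hρ0]
  · have := mul_le_mul_of_nonneg_left hxk' hd0
    have hdx := mul_le_mul_of_nonneg_right hd1 hρ0
    linarith only [this, hρ, hdx, hρ0]

/-- ★★★ **OUTPUT (a): THE LOOP MATRICES OF THE HOLOMORPHIC TOWER OF `e^{iX}U₀` STAY IN THE POLYDISC `‖W − 1‖ ≤ 1∕2`** at every level `j < k` — the `hpoly` letter of
✓`Node00.analyticAt_COfRecord`, k-uniformly on the traceless scaled polydisc. [cite: Balaban1987RG1, (0.4) p.253 («close to the identity»), (0.8) p.253; Balaban1985Variational, Prop. 9 p.309, (51)–(53) p.286] -/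
theorem norm_loopMh_iterMh_expOver_sub_one_le (U₀ : GaugeField P 0 (SU N)) (k : ℕ) (hU₀ : SmallBelow (fun j => blockAvg (P := P) (j := j) expMeanLogSU) k U₀)
    (εs : ℕ → ℝ) (hε0 : ∀ j, 0 ≤ εs j)
    (hε : ∀ j, j < k → ∀ (c : PBond P (j + 1)) (i : Idx P), ‖loopM (coeField (Averaging.iter (fun j => blockAvg (P := P) (j := j) expMeanLogSU) j U₀)) c i - 1‖ ≤ εs j)
    (hε50 : ∀ j, j < k → εs j ≤ 1 / 50)
    {X : PBond P 0 → Matrix (Fin N) (Fin N) ℂ} (hX : ∀ b, (X b).trace = 0)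
    (hρ : 8 * ((P.d : ℝ) + 1) * ((P.L : ℝ) ^ k * (2 * ‖X‖)) ≤ 1 / 10 ^ 6)
    (hQ : 2 * (20000000 * ((P.d : ℝ) + 1) ^ 2 * P.L) * ((P.L : ℝ) ^ k * (2 * ‖X‖)) + (60000 * ((P.d : ℝ) + 1)) * (Finset.range k).sum εs ≤ 1 / 2)
    (hN : ∀ j, j < k → (N : ℝ) * (56 * ((P.d : ℝ) + 1) * ((P.L : ℝ) ^ k * (2 * ‖X‖)) + εs j) ≤ 3)
    {j : ℕ} (hjk : j < k) (c : PBond P (j + 1)) (i : Idx P) :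
    ‖loopMh (iterMh j (expOver U₀ X)) c i - 1‖ ≤ 1 / 2 := by
  have hd1 : (1 : ℝ) ≤ P.d := by exact_mod_cast P.hd
  have hL2 : (2 : ℝ) ≤ P.L := by exact_mod_cast P.hL.2
  have hs₀ : 0 ≤ 2 * ‖X‖ := by positivity
  have hA : (0 : ℝ) ≤ 20000000 * ((P.d : ℝ) + 1) ^ 2 * P.L := by positivity
  have hB : (0 : ℝ) ≤ 60000 * ((P.d : ℝ) + 1) := by positivity
  obtain ⟨G, Vt, hGdet, hGn, hVdet, hVn, hiter⟩ := tower_induction U₀ k hU₀ εs hε0 hε hε50 hX hρ hQ hN j hjk.le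
  obtain ⟨hQ0, hQh⟩ := accumQ_le hA hB hs₀ hL2 hε0 hQ hjk.le
  obtain ⟨hS2, hκ, hφ0, hlam0, hg⟩ := level_sizes P.hd P.hL.2 hjk hs₀ hQ0 hQh hρ
  have hκ1 : ((1 + 2 * ((P.L : ℝ) ^ j * (2 * ‖X‖) * (1 + 2 * _))) ^ (P.d * P.L) - 1) + ((1 + 2 * ((P.L : ℝ) ^ j * (2 * ‖X‖) * (1 + 2 * _))) ^ P.L - 1) ≤ 1 / 10 ^ 6 := hκ
  have hε6 : εs j ≤ 1 / 6 := (hε50 j hjk).trans (by norm_num)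
  have hloop := norm_loopMh_sub_one_le (Averaging.iter (fun j => blockAvg (P := P) (j := j) expMeanLogSU) j U₀) hVdet hVn hS2 le_rfl le_rfl
    (by linarith only [hκ1, hlam0]) (by linarith only [hκ1, hφ0]) (by linarith only [hκ1]) (hε j hjk) hε6 c i
  rw [hiter, loopMh_gaugeSL G hGdet Vt c i]
  refine (norm_conj_inv_sub_one_le (hGdet _) (hGn _) (hg.trans (by norm_num))).trans ?_
  have hε' := hε50 j hjk
  have hl0 := norm_nonneg (loopMh Vt c i - 1)
  nlinarith only [hloop, hκ1, hε', hg, hl0, hd1, mul_nonneg (mul_nonneg (by positivity : (0:ℝ) ≤ 128 * (P.d : ℝ)) (mul_nonneg (pow_nonneg (by linarith only [hL2] : (0:ℝ) ≤ P.L) j) hs₀)) hl0]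

/-- ★★★ **OUTPUT (b): THE LOG-DISC LETTER AND THE LINEAR BOUND AT THE TOP LEVEL**: `‖Ū^k_h(e^{iX}U₀)(c)·Ū^k(U₀)(c)⋆ − 1‖ ≤ 1600(d+1)·(L^k‖X‖)` — the `hlog` letter of
✓`Node00.analyticAt_COfRecord` and the `C₀` of F4′-0's ✓`norm_logChart_iterMh_sub_qCplxOp_le_of_linearBound` (`C₀ = 1600(d+1)`, depending on `d` only).
[cite: Balaban1985Variational, (44) p.285, (52) p.286; Balaban1985Averaging, Proposition 7 p.43; Balaban1987RG1, (0.8) p.253] -/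
theorem norm_iterMh_expOver_mul_star_sub_one_le (U₀ : GaugeField P 0 (SU N)) (k : ℕ) (hU₀ : SmallBelow (fun j => blockAvg (P := P) (j := j) expMeanLogSU) k U₀)
    (εs : ℕ → ℝ) (hε0 : ∀ j, 0 ≤ εs j)
    (hε : ∀ j, j < k → ∀ (c : PBond P (j + 1)) (i : Idx P), ‖loopM (coeField (Averaging.iter (fun j => blockAvg (P := P) (j := j) expMeanLogSU) j U₀)) c i - 1‖ ≤ εs j)
    (hε50 : ∀ j, j < k → εs j ≤ 1 / 50)
    {X : PBond P 0 → Matrix (Fin N) (Fin N) ℂ} (hX : ∀ b, (X b).trace = 0)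
    (hρ : 8 * ((P.d : ℝ) + 1) * ((P.L : ℝ) ^ k * (2 * ‖X‖)) ≤ 1 / 10 ^ 6)
    (hQ : 2 * (20000000 * ((P.d : ℝ) + 1) ^ 2 * P.L) * ((P.L : ℝ) ^ k * (2 * ‖X‖)) + (60000 * ((P.d : ℝ) + 1)) * (Finset.range k).sum εs ≤ 1 / 2)
    (hN : ∀ j, j < k → (N : ℝ) * (56 * ((P.d : ℝ) + 1) * ((P.L : ℝ) ^ k * (2 * ‖X‖)) + εs j) ≤ 3) (c : PBond P k) :
    ‖iterMh k (expOver U₀ X) c * star ((Averaging.iter (fun j => blockAvg (P := P) (j := j) expMeanLogSU) k U₀ c : SU N) : Matrix (Fin N) (Fin N) ℂ) - 1‖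
      ≤ 1600 * ((P.d : ℝ) + 1) * ((P.L : ℝ) ^ k * ‖X‖) := by
  have hd1 : (1 : ℝ) ≤ P.d := by exact_mod_cast P.hd
  have hL2 : (2 : ℝ) ≤ P.L := by exact_mod_cast P.hL.2
  have hs₀ : 0 ≤ 2 * ‖X‖ := by positivity
  have hA : (0 : ℝ) ≤ 20000000 * ((P.d : ℝ) + 1) ^ 2 * P.L := by positivity
  have hB : (0 : ℝ) ≤ 60000 * ((P.d : ℝ) + 1) := by positivity
  have hρ0 : 0 ≤ (P.L : ℝ) ^ k * (2 * ‖X‖) := by positivity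
  obtain ⟨G, Vt, hGdet, hGn, hVdet, hVn, hiter⟩ := tower_induction U₀ k hU₀ εs hε0 hε hε50 hX hρ hQ hN k le_rfl
  obtain ⟨hQ0, hQh⟩ := accumQ_le hA hB hs₀ hL2 hε0 hQ le_rfl
  set W : Matrix (Fin N) (Fin N) ℂ := ((Averaging.iter (fun j => blockAvg (P := P) (j := j) expMeanLogSU) k U₀ c : SU N) : Matrix (Fin N) (Fin N) ℂ) with hW
  have hWu : W ∈ Matrix.unitaryGroup (Fin N) ℂ := Matrix.specialUnitaryGroup_le_unitaryGroup (Averaging.iter _ k U₀ c).2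
  have hWW : star W * W = 1 := Unitary.star_mul_self_of_mem hWu
  -- `V_k(c)·W⋆ = G(y)·(Ṽ(c)W⋆)·(W·G(y′)⁻¹·W⋆)`
  have hid : iterMh k (expOver U₀ X) c * star W = G c.src * (Vt c * star W) * (W * (G c.tgt)⁻¹ * star W) := by
    rw [hiter]
    rw [show G c.src * Vt c * (G c.tgt)⁻¹ * star W = G c.src * Vt c * (star W * W) * (G c.tgt)⁻¹ * star W by rw [hWW, mul_one]]
    simp only [mul_assoc]
  rw [hid]
  have hg : ‖G c.src - 1‖ ≤ 128 * (P.d : ℝ) * ((P.L : ℝ) ^ k * (2 * ‖X‖)) := hGn _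
  have hg2 : 128 * (P.d : ℝ) * ((P.L : ℝ) ^ k * (2 * ‖X‖)) ≤ 1 / 2 := by
    have := mul_le_mul_of_nonneg_left (le_refl ((P.L : ℝ) ^ k * (2 * ‖X‖))) (by linarith only [hd1] : (0:ℝ) ≤ P.d)
    nlinarith only [hρ, hd1, hρ0]
  have hS : ‖Vt c * star W - 1‖ ≤ 2 * ((P.L : ℝ) ^ k * (2 * ‖X‖)) := (hVn c).trans (by nlinarith only [hρ0, hQh])
  have hC : ‖W * (G c.tgt)⁻¹ * star W - 1‖ ≤ 2 * (128 * (P.d : ℝ) * ((P.L : ℝ) ^ k * (2 * ‖X‖))) := by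
    rw [norm_unitary_conj_sub_one_eq hWu]
    exact norm_inv_sub_one_le_of_det (sl_isUnit_det (hGdet _)) (hGn _) hg2
  have h4 := norm_mul4_sub_one_le hg hS hC (show ‖(1 : Matrix (Fin N) (Fin N) ℂ) - 1‖ ≤ 0 by rw [sub_self, norm_zero])
  rw [mul_one] at h4
  have htail := prod4_sub_one_le_two_mul (by positivity : (0:ℝ) ≤ 128 * (P.d : ℝ) * ((P.L : ℝ) ^ k * (2 * ‖X‖))) (by positivity : (0:ℝ) ≤ 2 * ((P.L : ℝ) ^ k * (2 * ‖X‖)))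
    (by positivity : (0:ℝ) ≤ 2 * (128 * (P.d : ℝ) * ((P.L : ℝ) ^ k * (2 * ‖X‖)))) le_rfl (by nlinarith only [hρ, hd1, hρ0, hg2])
  refine h4.trans (htail.trans ?_)
  nlinarith only [hρ0, hd1]

end Summit.QuantumFields.YangMills.Theorems.C44IterMh

end
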